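import Mathlib
import HarnessLib
import Summits.RiemannHypothesis.RiemannHypothesis.Theorems.DbrWallAntipersistenceLogFive

/-!
# DBR column, rung B-P(P1): elementary constants for the anti-persistence certificate at mesh `(log 7)/2`

RH-FREE elementary inequalities (LINE 1 of the label discipline): bounds on `7^{1/4}`, `log(7/3)`, `log(7/4)`,
`log(7/5)` and on the prime terms of the two-point gap at `s₁ = (log 7)/2`; used by
`DbrWallAntipersistenceLogSeven` (`Ψ(2s) < 2Ψ(s)` for `0 < s ≤ (log 7)/2`). Nothing here bears on the truth of RH.

Method [folklore]: `ρ⁴ = 7` by `exp_log`; logarithms from `Real.abs_log_sub_add_sum_range_le` (the series of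
`−log(1 − x)` at `x = 4/7, 3/7, 2/7`), `log 5 = 2 log 2 + log(5/4)`, `log 3 = log 2 + log(3/2)`, Mathlib's
`Real.log_two_gt_d9`, and `√q < c` from `(√q)² = q`. -/

set_option linter.dupNamespace false

noncomputable section

open scoped BigOperators
open Set
namespace Summit.RiemannHypothesis.RiemannHypothesis.Theorems.DbrWall

open Literature.NumberTheory.LFunctions

/-- `ρ := e^{(log 7)/4} = 7^{1/4}`: `ρ⁴ = 7` and `1.626576 < ρ < 1.626577`. [folklore] -/
theorem exp_log_seven_div_four_bounds :
    Real.exp (Real.log 7 / 4) ^ 4 = 7 ∧ (1.626576 : ℝ) < Real.exp (Real.log 7 / 4)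
      ∧ Real.exp (Real.log 7 / 4) < 1.626577 := by
  set r := Real.exp (Real.log 7 / 4) with hr
  have hr0 : 0 < r := Real.exp_pos _
  have hr4 : r ^ 4 = 7 := by
    rw [← Real.exp_nat_mul, show ((4 : ℕ) : ℝ) * (Real.log 7 / 4) = Real.log 7 by push_cast; ring,
      Real.exp_log (by norm_num)]
  refine ⟨hr4, ?_, ?_⟩
  · by_contra h
    push Not at h
    have := pow_le_pow_left₀ hr0.le h 4
    rw [hr4] at this
    norm_num at this
  · by_contra h
    push Not at h
    have := pow_le_pow_left₀ (by norm_num) h 4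
    rw [hr4] at this
    norm_num at this

/-- The gap exponentials at `s₁ = (log 7)/2`: `e^{−λ'_k s₁} = 7^{−(k+1)}·ρ⁻¹`. [folklore] -/
theorem exp_neg_lam_mul_half_log_seven (k : ℕ) :
    Real.exp (-((2 * (k : ℝ) + 5 / 2) * (Real.log 7 / 2)))
      = (1 / 7 : ℝ) ^ (k + 1) * (Real.exp (Real.log 7 / 4))⁻¹ := by
  set r := Real.exp (Real.log 7 / 4) with hr
  have hr4 := exp_log_seven_div_four_bounds.1
  have h1 : Real.exp (-((2 * (k : ℝ) + 5 / 2) * (Real.log 7 / 2))) = r⁻¹ ^ (4 * k + 5) := by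
    rw [show (2 * (k : ℝ) + 5 / 2) * (Real.log 7 / 2) = ((4 * k + 5 : ℕ) : ℝ) * (Real.log 7 / 4) by
      push_cast; ring, Real.exp_neg, Real.exp_nat_mul, inv_pow]
  have h2 : r⁻¹ ^ (4 * k + 5) = (r⁻¹ ^ 4) ^ (k + 1) * r⁻¹ := by ring
  have h3 : r⁻¹ ^ 4 = 1 / 7 := by rw [inv_pow, hr4, one_div]
  rw [h1, h2, h3]

/-- `log(7/3) > 0.8472977` (thirty terms of `−log(1 − 4/7)`). [folklore] -/
theorem log_seven_thirds_gt : (0.8472977 : ℝ) < Real.log (7 / 3) := by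
  have hx : |(4 / 7 : ℝ)| < 1 := by rw [abs_of_pos (by norm_num)]; norm_num
  have h := Real.abs_log_sub_add_sum_range_le hx 30
  have hlog : Real.log (1 - 4 / 7 : ℝ) = -Real.log (7 / 3) := by
    rw [show (1 - 4 / 7 : ℝ) = (7 / 3)⁻¹ by norm_num, Real.log_inv]
  rw [hlog, abs_of_pos (by norm_num : (0 : ℝ) < 4 / 7)] at h
  have h' := (abs_le.1 h).2
  simp only [Finset.sum_range_succ, Finset.sum_range_zero] at h'
  norm_num at h'
  linarith

/-- `log(7/4) > 0.5596157` (twenty terms of `−log(1 − 3/7)`). [folklore] -/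
theorem log_seven_fourths_gt : (0.5596157 : ℝ) < Real.log (7 / 4) := by
  have hx : |(3 / 7 : ℝ)| < 1 := by rw [abs_of_pos (by norm_num)]; norm_num
  have h := Real.abs_log_sub_add_sum_range_le hx 20
  have hlog : Real.log (1 - 3 / 7 : ℝ) = -Real.log (7 / 4) := by
    rw [show (1 - 3 / 7 : ℝ) = (7 / 4)⁻¹ by norm_num, Real.log_inv]
  rw [hlog, abs_of_pos (by norm_num : (0 : ℝ) < 3 / 7)] at h
  have h' := (abs_le.1 h).2
  simp only [Finset.sum_range_succ, Finset.sum_range_zero] at h'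
  norm_num at h'
  linarith

/-- `log(7/5) > 0.3364721` (twelve terms of `−log(1 − 2/7)`). [folklore] -/
theorem log_seven_fifths_gt : (0.3364721 : ℝ) < Real.log (7 / 5) := by
  have hx : |(2 / 7 : ℝ)| < 1 := by rw [abs_of_pos (by norm_num)]; norm_num
  have h := Real.abs_log_sub_add_sum_range_le hx 12
  have hlog : Real.log (1 - 2 / 7 : ℝ) = -Real.log (7 / 5) := by
    rw [show (1 - 2 / 7 : ℝ) = (7 / 5)⁻¹ by norm_num, Real.log_inv]
  rw [hlog, abs_of_pos (by norm_num : (0 : ℝ) < 2 / 7)] at h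
  have h' := (abs_le.1 h).2
  simp only [Finset.sum_range_succ, Finset.sum_range_zero] at h'
  norm_num at h'
  linarith

/-- The prime terms at `s₁ = (log 7)/2`: they sum to
`(log 2)²/√2 + (log 3/√3)·log(7/3) + (log 2/2)·log(7/4) + (log 5/√5)·log(7/5) > 1.3132`. [folklore] -/
theorem prime_terms_half_log_seven_gt :
    (1.3132 : ℝ) < Real.log 2 / Real.sqrt 2 * (2 * (Real.log 7 / 2) - Real.log 2)
      + Real.log 3 / Real.sqrt 3 * (2 * (Real.log 7 / 2) - Real.log 3)
      + Real.log 2 / 2 * (2 * (Real.log 7 / 2) - Real.log 4)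
      + Real.log 5 / Real.sqrt 5 * (2 * (Real.log 7 / 2) - Real.log 5)
      - 2 * (Real.log 2 / Real.sqrt 2 * (Real.log 7 / 2 - Real.log 2)) := by
  have h73 : 2 * (Real.log 7 / 2) - Real.log 3 = Real.log (7 / 3) := by
    rw [Real.log_div (by norm_num) (by norm_num)]; ring
  have h74 : 2 * (Real.log 7 / 2) - Real.log 4 = Real.log (7 / 4) := by
    rw [Real.log_div (by norm_num) (by norm_num)]; ring
  have h75 : 2 * (Real.log 7 / 2) - Real.log 5 = Real.log (7 / 5) := by
    rw [Real.log_div (by norm_num) (by norm_num)]; ring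
  have hgoal : Real.log 2 / Real.sqrt 2 * (2 * (Real.log 7 / 2) - Real.log 2)
      + Real.log 3 / Real.sqrt 3 * (2 * (Real.log 7 / 2) - Real.log 3)
      + Real.log 2 / 2 * (2 * (Real.log 7 / 2) - Real.log 4)
      + Real.log 5 / Real.sqrt 5 * (2 * (Real.log 7 / 2) - Real.log 5)
      - 2 * (Real.log 2 / Real.sqrt 2 * (Real.log 7 / 2 - Real.log 2))
      = Real.log 2 / Real.sqrt 2 * Real.log 2 + Real.log 3 / Real.sqrt 3 * Real.log (7 / 3)
        + Real.log 2 / 2 * Real.log (7 / 4) + Real.log 5 / Real.sqrt 5 * Real.log (7 / 5) := by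
    rw [h73, h74, h75]; ring
  rw [hgoal]
  have hl2 := Real.log_two_gt_d9
  have hl73 := log_seven_thirds_gt
  have hl74 := log_seven_fourths_gt
  have hl75 := log_seven_fifths_gt
  have hl3 : (1.09852 : ℝ) < Real.log 3 := by
    have h := log_three_halves_gt
    have : Real.log 3 = Real.log 2 + Real.log (3 / 2) := by
      rw [Real.log_div (by norm_num) (by norm_num)]; ring
    linarith
  have hl5 : (1.609436 : ℝ) < Real.log 5 := by
    have h := log_five_fourths_gt
    have : Real.log 5 = 2 * Real.log 2 + Real.log (5 / 4) := by
      rw [Real.log_div (by norm_num) (by norm_num), show (4 : ℝ) = 2 ^ 2 by norm_num, Real.log_pow]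
      push_cast; ring
    linarith
  have hs2 : 0 < Real.sqrt 2 := Real.sqrt_pos.2 (by norm_num)
  have hs3 : 0 < Real.sqrt 3 := Real.sqrt_pos.2 (by norm_num)
  have hs5 : 0 < Real.sqrt 5 := Real.sqrt_pos.2 (by norm_num)
  have hs2u : Real.sqrt 2 < 1.41422 := by
    have h := Real.sq_sqrt (show (0 : ℝ) ≤ 2 by norm_num)
    nlinarith [Real.sqrt_nonneg 2]
  have hs3u : Real.sqrt 3 < 1.73206 := by
    have h := Real.sq_sqrt (show (0 : ℝ) ≤ 3 by norm_num)
    nlinarith [Real.sqrt_nonneg 3]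
  have hs5u : Real.sqrt 5 < 2.23607 := by
    have h := Real.sq_sqrt (show (0 : ℝ) ≤ 5 by norm_num)
    nlinarith [Real.sqrt_nonneg 5]
  have hA : (0.33973 : ℝ) < Real.log 2 / Real.sqrt 2 * Real.log 2 := by
    rw [div_mul_eq_mul_div, lt_div_iff₀ hs2]
    have hp : (0.6931471803 : ℝ) * 0.6931471803 ≤ Real.log 2 * Real.log 2 :=
      mul_le_mul hl2.le hl2.le (by norm_num) (by linarith)
    nlinarith
  have hB : (0.53737 : ℝ) < Real.log 3 / Real.sqrt 3 * Real.log (7 / 3) := by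
    rw [div_mul_eq_mul_div, lt_div_iff₀ hs3]
    have hp : (1.09852 : ℝ) * 0.8472977 ≤ Real.log 3 * Real.log (7 / 3) :=
      mul_le_mul hl3.le hl73.le (by norm_num) (by linarith)
    nlinarith
  have hC : (0.19394 : ℝ) < Real.log 2 / 2 * Real.log (7 / 4) := by nlinarith
  have hD : (0.24217 : ℝ) < Real.log 5 / Real.sqrt 5 * Real.log (7 / 5) := by
    rw [div_mul_eq_mul_div, lt_div_iff₀ hs5]
    have hp : (1.609436 : ℝ) * 0.3364721 ≤ Real.log 5 * Real.log (7 / 5) :=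
      mul_le_mul hl5.le hl75.le (by norm_num) (by linarith)
    nlinarith
  linarith

end Summit.RiemannHypothesis.RiemannHypothesis.Theorems.DbrWall
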